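import Summits.BirchSwinnertonDyer.BirchSwinnertonDyer.Theorems.ManinLocalTwoThreeShimuraQuotientCuspidalInertia
import Literature.NumberTheory.EllipticCurves.Gamma1ParametrizationCuspGaloisAction
import Literature.NumberTheory.EllipticCurves.ManinConstantGamma1Gamma0Comparison
import HarnessLib

/-!
# THEOREM K, CORE (D5 of the `kummer_diamond` line): the Galois action on the fibre point `P_y = φ₁(1/y)` over an Atkin–Lehner cusp is
# TRANSLATION BY THE DIAMOND CHARACTER — `σ(P_y) = P_y + φ₁(γ∞)` with `d(γ) ≡ d′ (mod Q)`, `≡ 1 (mod N/Q)` — from Stevens 1982 Thm. 1.3.1(b)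
(route `ManinLocalTwoThree`, crux C2 `ManinOddAtFour` stmt-BirchSwinnertonDyer-22967; cell bsd-f2-manin, prover p2 gen 21; es g38 MEMO-es §59.3 / PROOF-Ees185-186.md §2;
`--supports stmt-BirchSwinnertonDyer-22967`)

INPUT (printed, statement-only, landed by -ty as T-es-75): `optimalGamma1Parametrization_cuspInv_galoisAction` — for an OPTIMAL `X₁(N)`-datum `D`,
`σ ∈ Aut_ℚ(ℂ)` with `σ(ζ_N) = ζ_N^d`, `dd′ ≡ 1 (mod N)`: `σ(D.uniformize (c·{∞,1/y}_f)) = D.uniformize (c·{∞,1/(d′y)}_f)` (Stevens: `[1;y]^{τ_d} = [1;d′y]`).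

THIS FILE (no CDT, no index-`4` hypothesis, no `2`-descent):
* §1 `exists_gamma0_inv_mul_eq` — the MATRIX LEMMA: for `N = Q·y` with `gcd(Q, y) = 1` and `d′ ≠ 0` coprime to `N` there is
  `γ = (1 − by, b; −kN, d′ + kQ) ∈ Γ₀(N)` (Bezout `kQ − b·d′y = 1 − d′`) with `γ·(1/y) = 1/(d′y)` EXACTLY (`(a/y + b)/(c/y + δ) = 1/(d′y)`, `c/y + δ = d′`),
  lower-right entry `≡ d′ (mod Q)` and `≡ 1 (mod y)` — es's `e_d` (§59.3: «`[1; d′N/Q] = ⟨e⟩[1;N/Q]` iff `e ≡ ±d′ (Q)`, `e ≡ ±1 (N/Q)`»);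
* §2 `modularSymbol_inv_mul_eq` — Manin's relation (`modularSymbol_gamma0_smul_holds`) at `r = 1/y`: `{∞, 1/(d′y)}_f = {∞, γ∞}_f + {∞, 1/y}_f`;
* §3 **`theoremK_core`** — `optimalGamma1Parametrization_cuspInv_galoisAction → D.IsOptimal → (1 < N = Q·y, gcd(Q,y) = 1, σ(ζ_N) = ζ_N^d, dd′ ≡ 1 (N)) →
  ∃ γ ∈ Γ₀(N), d(γ) ≡ d′ (mod Q) ∧ d(γ) ≡ 1 (mod y) ∧ Affine.Point.map σ (D.uniformize (c·{∞,1/y}_f)) = D.uniformize (c·{∞,1/y}_f) + D.uniformize (c·{∞,γ∞}_f)`: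
  the Kummer class of the Shimura fibre over `w_Q∞` is the `Q`-component of the diamond character composed with `χ_Q⁻¹` (MEMO-es §59.3 THEOREM K;
  its E38 census 124/124), CDT-free and index-free.  The translation `D.uniformize (c·{∞,γ∞}_f)` is the diamond value `ϖ(e_d)` (a rational torsion
  point by F★), the input of STEP 2 (D6).
HONEST FRAMING.  CONDITIONAL on the printed fact T-es-75 (statement-only); nothing about E-es-185, C2, Manin's conjecture or BSD is proved here.  No definitions,
no sorry. [cite: Stevens1982, §1.3 Thm. 1.3.1(b) (pp. 13–14)] [cite: Manin1972, Prop. 1.4 / Thm. 1.6 (Manin relation)] [cite: ConradEdixhovenStein2003, §6.1.2]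
-/

set_option autoImplicit false
-- lint-debt: the directory name repeats the summit name (sibling precedent `ManinLocalTwoThreeShimuraQuotientCuspidalInertia.lean`)
set_option linter.dupNamespace false

noncomputable section

open scoped MatrixGroups ModularForm
open CongruenceSubgroup WeierstrassCurve Literature.NumberTheory.EllipticCurves Literature.NumberTheory.EllipticCurves.ModularForms

namespace Summit.BirchSwinnertonDyer.BirchSwinnertonDyer.Theorems.ManinLocalTwoThree.TheoremK

variable {N : ℕ} [NeZero N]

/-! ## §1 The matrix lemma: `γ·(1/y) = 1/(d′y)` with prescribed diamond class -/

omit [NeZero N] in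
/-- **The matrix lemma.**  `N = Q·y`, `gcd(Q, y) = 1`, `d′ ≠ 0` coprime to `N`: there is `γ ∈ Γ₀(N)` with `c_γ/y + d_γ = d′`,
`(a_γ/y + b_γ)/(c_γ/y + d_γ) = 1/(d′y)`, `d_γ ≡ d′ (mod Q)` and `d_γ ≡ 1 (mod y)`.  Construction: Bezout `kQ − b·(d′y) = 1 − d′`,
`γ = (1 − by, b; −kN, d′ + kQ)`. [cite: Stevens1982, §1.3 (cusp equivalence for Γ₁(N))] -/
theorem exists_gamma0_inv_mul_eq {Q y : ℕ} (hN : N = Q * y) (hQy : Nat.Coprime Q y) (hy : y ≠ 0) {d' : ℤ} (hd0 : d' ≠ 0)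
    (hd' : IsCoprime d' (N : ℤ)) :
    ∃ γ : Gamma0 N,
      (((γ : SL(2, ℤ)) 1 0 : ℤ) : ℚ) * (1 / (y : ℚ)) + ((γ : SL(2, ℤ)) 1 1 : ℤ) = d' ∧
      ((((γ : SL(2, ℤ)) 0 0 : ℤ) : ℚ) * (1 / (y : ℚ)) + ((γ : SL(2, ℤ)) 0 1 : ℤ)) /
        ((((γ : SL(2, ℤ)) 1 0 : ℤ) : ℚ) * (1 / (y : ℚ)) + ((γ : SL(2, ℤ)) 1 1 : ℤ)) = 1 / ((d' : ℚ) * y) ∧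
      ((((γ : SL(2, ℤ)) 1 1 : ℤ)) : ZMod Q) = (d' : ZMod Q) ∧
      ((((γ : SL(2, ℤ)) 1 1 : ℤ)) : ZMod y) = 1 := by
  -- Bezout for `gcd(Q, d′y) = 1`
  have hQN : (Q : ℤ) ∣ (N : ℤ) := ⟨y, by rw [hN]; push_cast; ring⟩
  have hcop : IsCoprime (Q : ℤ) (d' * y) :=
    IsCoprime.mul_right (hd'.symm.of_isCoprime_of_dvd_left hQN) (Nat.isCoprime_iff_coprime.mpr hQy)
  obtain ⟨k₀, b₀, hkb⟩ := hcop
  set k : ℤ := k₀ * (1 - d') with hk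
  set b : ℤ := -(b₀ * (1 - d')) with hb
  have hbez : k * Q - b * (d' * y) = 1 - d' := by rw [hk, hb]; linear_combination (1 - d') * hkb
  let M : SL(2, ℤ) := ⟨!![1 - b * y, b; -(k * (N : ℤ)), d' + k * Q], by
    rw [Matrix.det_fin_two_of, hN]; push_cast; linear_combination hbez⟩
  have hM : M ∈ Gamma0 N := by
    rw [Gamma0_mem]
    simp only [M, Matrix.of_apply, Matrix.cons_val', Matrix.cons_val_zero, Matrix.cons_val_one, Matrix.cons_val_fin_one]
    push_cast
    simp
  have hy' : (y : ℚ) ≠ 0 := by exact_mod_cast hy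
  have hd0' : (d' : ℚ) ≠ 0 := by exact_mod_cast hd0
  have hNq : (N : ℚ) = (Q : ℚ) * y := by rw [hN]; push_cast; ring
  have hden : ((-(k * (N : ℤ)) : ℤ) : ℚ) * (1 / (y : ℚ)) + ((d' + k * Q : ℤ) : ℚ) = d' := by
    push_cast; rw [hNq]; field_simp; ring
  have hnum : ((1 - b * y : ℤ) : ℚ) * (1 / (y : ℚ)) + (b : ℤ) = 1 / (y : ℚ) := by
    push_cast; field_simp; ring
  refine ⟨⟨M, hM⟩, ?_, ?_, ?_, ?_⟩
  · simp only [M, Matrix.of_apply, Matrix.cons_val', Matrix.cons_val_zero, Matrix.cons_val_one, Matrix.cons_val_fin_one]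
    exact hden
  · simp only [M, Matrix.of_apply, Matrix.cons_val', Matrix.cons_val_zero, Matrix.cons_val_one, Matrix.cons_val_fin_one]
    rw [hden, hnum]
    field_simp
  · simp only [M, Matrix.of_apply, Matrix.cons_val', Matrix.cons_val_one, Matrix.cons_val_fin_one]
    push_cast
    simp
  · simp only [M, Matrix.of_apply, Matrix.cons_val', Matrix.cons_val_one, Matrix.cons_val_fin_one]
    have e : d' + k * Q = 1 + b * d' * y := by linear_combination hbez
    rw [e]; push_cast; simp

/-! ## §2 Manin's relation at `r = 1/y` -/

/-- **`{∞, 1/(d′y)}_f = {∞, γ∞}_f + {∞, 1/y}_f`** for the matrix `γ` of §1 (`γ·(1/y) = 1/(d′y)`; Manin relation `modularSymbol_gamma0_smul_holds`).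
[cite: Manin1972, Prop. 1.4 / Thm. 1.6] -/
theorem modularSymbol_inv_mul_eq (f : CuspForm (Gamma0 N) 2) {y : ℕ} {d' : ℤ} (hd0 : d' ≠ 0) (γ : Gamma0 N)
    (hden : (((γ : SL(2, ℤ)) 1 0 : ℤ) : ℚ) * (1 / (y : ℚ)) + ((γ : SL(2, ℤ)) 1 1 : ℤ) = d')
    (hval : ((((γ : SL(2, ℤ)) 0 0 : ℤ) : ℚ) * (1 / (y : ℚ)) + ((γ : SL(2, ℤ)) 0 1 : ℤ)) /
        ((((γ : SL(2, ℤ)) 1 0 : ℤ) : ℚ) * (1 / (y : ℚ)) + ((γ : SL(2, ℤ)) 1 1 : ℤ)) = 1 / ((d' : ℚ) * y)) :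
    modularSymbol f (1 / ((d' : ℚ) * y)) = cuspSymbol f γ + modularSymbol f (1 / (y : ℚ)) := by
  have hr : (((γ : SL(2, ℤ)) 1 0 : ℤ) : ℚ) * (1 / (y : ℚ)) + ((γ : SL(2, ℤ)) 1 1 : ℤ) ≠ 0 := by
    rw [hden]; exact_mod_cast hd0
  have key := modularSymbol_gamma0_smul_holds f γ (1 / (y : ℚ)) hr
  rwa [hval] at key

/-! ## §3 THEOREM K, core form -/

/-- **THEOREM K (core, datum form).**  For an OPTIMAL `X₁(N)`-datum `D` of an elliptic `W/ℚ`, a level `N = Q·y > 1` with `gcd(Q, y) = 1` (so `1/y`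
is the Atkin–Lehner cusp `w_Q∞ = 1/(N/Q)`), and `σ ∈ Aut_ℚ(ℂ)` with `σ(ζ_N) = ζ_N^d`, `dd′ ≡ 1 (mod N)`: MODULO Stevens' printed theorem
`optimalGamma1Parametrization_cuspInv_galoisAction`, there is `γ ∈ Γ₀(N)` with `d_γ ≡ d′ (mod Q)`, `d_γ ≡ 1 (mod y)` and
`σ(D.uniformize (c·{∞,1/y}_f)) = D.uniformize (c·{∞,1/y}_f) + D.uniformize (c·{∞,γ∞}_f)` — the Galois action on the fibre point over `w_Q∞` is
translation by the value of the diamond character at `e_d` (`e_d ≡ d⁻¹ (Q)`, `≡ 1 (N/Q)`).  CONDITIONAL on T-es-75; CDT-free, index-free.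
[cite: Stevens1982, §1.3 Thm. 1.3.1(b)] [cite: Manin1972, Prop. 1.4 / Thm. 1.6] [cite: ConradEdixhovenStein2003, §6.1.2] -/
theorem theoremK_core (hGal : optimalGamma1Parametrization_cuspInv_galoisAction)
    {W : WeierstrassCurve ℚ} [W.IsElliptic] (D : Gamma1ParametrizationData W N) (hopt : D.IsOptimal)
    {Q y : ℕ} (hNQy : N = Q * y) (hQy : Nat.Coprime Q y) (hN1 : 1 < N)
    (σ : ℂ ≃ₐ[ℚ] ℂ) {d d' : ℤ} (hdd' : ((d * d' : ℤ) : ZMod N) = 1)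
    (hσ : σ (Complex.exp (2 * Real.pi * Complex.I / N)) = Complex.exp (2 * Real.pi * Complex.I * d / N)) :
    ∃ γ : Gamma0 N, ((((γ : SL(2, ℤ)) 1 1 : ℤ)) : ZMod Q) = (d' : ZMod Q) ∧ ((((γ : SL(2, ℤ)) 1 1 : ℤ)) : ZMod y) = 1 ∧
      Affine.Point.map (W' := W) (σ : ℂ →ₐ[ℚ] ℂ) (D.uniformize ((D.c : ℂ) * modularSymbol D.f (1 / y))) =
        D.uniformize ((D.c : ℂ) * modularSymbol D.f (1 / y)) + D.uniformize ((D.c : ℂ) * cuspSymbol D.f γ) := by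
  have hy : y ≠ 0 := by rintro rfl; rw [mul_zero] at hNQy; exact (NeZero.ne N) hNQy
  -- `d′ ≠ 0` and `gcd(d′, N) = 1` from `dd′ ≡ 1 (mod N)`, `N > 1`
  haveI : Fact (1 < N) := ⟨hN1⟩
  have hd0 : d' ≠ 0 := by
    rintro rfl
    rw [mul_zero, Int.cast_zero] at hdd'
    exact zero_ne_one hdd'
  have hd' : IsCoprime d' (N : ℤ) := by
    have h1 : ((d * d' - 1 : ℤ) : ZMod N) = 0 := by push_cast; rw [← Int.cast_mul, hdd', sub_self]
    obtain ⟨m, hm⟩ := (ZMod.intCast_zmod_eq_zero_iff_dvd _ N).mp h1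
    exact ⟨d, -m, by linear_combination hm⟩
  obtain ⟨γ, hden, hval, hQ, hY⟩ := exists_gamma0_inv_mul_eq hNQy hQy hy hd0 hd'
  refine ⟨γ, hQ, hY, ?_⟩
  have hy0 : (y : ℤ) ≠ 0 := by exact_mod_cast hy
  have h := hGal W D hopt σ d d' hdd' hσ y hy0
  -- `{∞, 1/(d′y)} = {∞, γ∞} + {∞, 1/y}`
  have hms : modularSymbol D.f (1 / ((d' : ℚ) * y)) = cuspSymbol D.f γ + modularSymbol D.f (1 / (y : ℚ)) :=
    modularSymbol_inv_mul_eq D.f hd0 γ hden hval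
  simp only [Int.cast_natCast] at h
  rw [h, hms, mul_add, map_add, add_comm]

end Summit.BirchSwinnertonDyer.BirchSwinnertonDyer.Theorems.ManinLocalTwoThree.TheoremK

end
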